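import Summits.NavierStokesRegularity.FluidComputer.PalasekTowerGermHostStrictTiny
import Literature.Analysis.FluidPDE.BallRadialMoments

/-!
# The germ host, XXIV: a QUANTITATIVE anchor rate for the strict tiny profile — `rate⋆ ≥ Y₀³/200000`

Cell `ns-blowup`, seat `ns-blowup-ecbridge-3` (g5); GROUP C «BRIDGE SUPPORT» of the route
`PalasekTowerBreakdown` (crux `EpisodeBaseG`, item stmt-NavierStokesRegularity-19179, R2; lines `slot` v4 /
`explicit` v5 draft). Sequel of `PalasekTowerGermHostStrictTiny.lean` (g3: `strictTinyProfile a = U_a + W`,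
`W = farPusher`, strict anchor test `0 < ⟪U(0), V(0)⟫` QUALITATIVELY) and `PalasekTowerGermHostFlatPusher.lean`
(`pusherDensity`). LABEL: E–C typing (KERNEL, proofs only). WHAT THIS IS NOT: not Navier–Stokes evidence — one
explicit potential-theory number about a PRESCRIBED profile at one instant (the first-order rising rate of its
speed maximum under the NS acceleration); nothing about any flow after `τ₀`, `FirstEpisodeD`, `RungG 1` or
blow-up.

## What (refuter4 K97 (2)(ii) / ecbridge-3 g4 HANDOFF (iv), 2026-08-26)

The anchor value of the strict slot's kernel inhabitant, `rate⋆ = ⟪U(0), accel ν U 0⟫` (`U = strictTinyProfile a`),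
was only known to be `> 0` (`anchor_strictTinyProfile`; `LevelZeroData.rate` is a `Classical.choose`). Here:

* §1 `inner_accel_eq_integral_pusherDensity` — for a FLAT even carrier and an orthogonal far pusher the anchor
  value IS the integral of the explicit density (equality form of `inner_accel_pos_of_flat_forward`):
  `⟪U(x₀), V(x₀)⟫ = ∫ pusherDensity x₀ (U₁ x₀) U₂`, at every viscosity;
* §2 for the far pusher `W` (`⟪x, W x⟫ = 0` identically — `W ∥ (x − 5e₃) × e₃`): the density is
  `3 Y₀ ⟪x, e₃⟫ ‖x‖² ‖W x‖² / (4π ‖x‖⁷) ≥ 0`, and on the ball `B(5e₃, 7/10)` (where `⟪x, e₃⟫ ≥ 43/10`,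
  `‖x‖ ≤ 57/10`) it is `≥ (3/(4π)) · (43/10)/(57/10)⁵ · Y₀ ‖W x‖²`;
* §3 the pusher's energy on that ball, EXACTLY: `∫_{B(5e₃,7/10)} ‖W‖² = 6π J Y₀²`,
  `J = ∫₀^{7/10} r⁸(1 − r²)² dr = (7/10)⁹/9 − 2(7/10)¹¹/11 + (7/10)¹³/13` (flat zone of the potential:
  `‖W(5e₃ + p)‖² = (9/4) Y₀² ‖p‖⁴ (1 − ‖p‖²)² (‖p‖² − p₂²)`; polar coordinates and the weighted second moments of
  `Literature.Analysis.FluidPDE.BallRadialMoments`);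
* §4 **`rate_strictTinyProfile_ge`**: `Y₀³/200000 ≤ ⟪U(0), accel ν U 0⟫` for `0 < a ≤ 5/256` and every `ν`
  (`(9/2)·(43/10)(57/10)⁻⁵·J ≈ 5.25·10⁻⁶ ≥ 5·10⁻⁶`; numerically the full integral is `≈ 4.3·10⁻⁵ Y₀³`, so the
  bound is within a factor `≈ 8`); **`anchor_strictTinyProfile_ge`** (the same on the argmax `{0}`, `ν = 1`); and
  **`rate_add_farPusher_ge`**: the SAME numeric rate for ANY flat even carrier `U₁` (`tsupport ⊆ B̄(0, ρ₁)`,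
  `ρ₁ < 15/4`, `U₁(0) = Y₀e₃`) — the number belongs to the pusher, not to the carrier. The amplifier rule with
  this numeric budget is the sequel `PalasekTowerGermHostRateAmplifier.lean`.

With `Y₀ = 256^{1.3} ≈ 1351.2`: `rate⋆ ≥ Y₀³/200000 ≈ 1.23·10⁴` (level-`0` units, `ν = 1` slot).

References: D. Gilbarg, N. S. Trudinger, *Elliptic PDE of Second Order* (2001), Lemma 4.1 / (2.13)
[cite: GilbargTrudinger2001, Lemma 4.1]; A. J. Majda, A. L. Bertozzi, *Vorticity and Incompressible Flow* (CUP
2002), §1.8 Prop. 1.16 [cite: MajdaBertozziCUP2002, §1.8 Prop. 1.16]; G. B. Folland, *Real Analysis* (1999), §2.7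
[cite: Folland1999, Thm. 2.49]; S. Palasek, arXiv:2605.13827 §3.3 [cite: Palasek2026ElementaryModel, §3.3].
-/

noncomputable section

namespace Summit.NavierStokesRegularity.FluidComputer.PalasekTowerClayBridge.Germ

open Set Function Filter Topology InnerProductSpace Metric MeasureTheory Real
open scoped Topology ContDiff RealInnerProductSpace Laplacian

open Literature.Analysis.FluidPDE TinyBlob

-- nested operator types `ℝ³ →L[ℝ] ℝ³ →L[ℝ] ℝ` (third derivatives of the Newton kernel)
set_option maxSynthPendingDepth 3

/-! ## §1 The anchor value of a flat carrier with an orthogonal far pusher is the integral of the density -/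

/-- **EQUALITY FORM of `inner_accel_pos_of_flat_forward`.** `U = U₁ + U₂`, `U₁, U₂ ∈ C_c^∞` divergence free
with disjoint supports, `U₁` even about `x₀` and FLAT there (`ΔU₁(x₀) = 0`), `tsupport U₂` at distance
`> r > 0` from `x₀`, `U₂ ⊥ U₁(x₀)` pointwise. Then, at every viscosity `ν`,
`⟪U(x₀), V(x₀)⟫ = ∫ pusherDensity x₀ (U₁ x₀) U₂` — the viscous term vanishes by flatness and the pressure
push of `U₂` is the `D³Γ` integral, whose integrand is the explicit density. [cite: GilbargTrudinger2001, Lemma 4.1] -/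
theorem inner_accel_eq_integral_pusherDensity {ν : ℝ}
    {U₁ U₂ : EuclideanSpace ℝ (Fin 3) → EuclideanSpace ℝ (Fin 3)} {x₀ : EuclideanSpace ℝ (Fin 3)}
    (h₁ : ContDiff ℝ ∞ U₁) (h₁c : HasCompactSupport U₁) (hdiv₁ : VectorCalculus.IsDivFree U₁)
    (he : IsEvenAbout x₀ U₁) (hflat : (Δ U₁) x₀ = 0)
    (h₂ : ContDiff ℝ ∞ U₂) (h₂c : HasCompactSupport U₂) (hdiv₂ : VectorCalculus.IsDivFree U₂)
    (hd : Disjoint (tsupport U₁) (tsupport U₂)) {r : ℝ} (hr : 0 < r)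
    (hfar : ∀ x ∈ tsupport U₂, r < ‖x₀ - x‖) (hperp : ∀ x, ⟪U₂ x, U₁ x₀⟫ = 0) :
    ⟪(U₁ + U₂) x₀, accel ν (U₁ + U₂) x₀⟫ = ∫ x, pusherDensity x₀ (U₁ x₀) U₂ x := by
  have hx₀ : x₀ ∉ tsupport U₂ := fun h => by
    have := hfar x₀ h
    rw [sub_self, norm_zero] at this
    exact absurd this (not_lt.2 hr.le)
  rw [inner_accel_of_even_add_far h₁ h₁c hdiv₁ he h₂ h₂c hd hx₀, hflat, inner_zero_right, mul_zero,
    zero_sub, ← real_inner_comm (U₁ x₀) (gradient (pot ν U₂) x₀),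
    inner_gradient_pot_eq_neg_integral_fderiv3 h₂ h₂c hdiv₂ hr hfar (U₁ x₀), neg_neg]
  exact integral_congr_ae (ae_of_all _ fun x => fderiv3_integrand_eq_pusherDensity hperp hx₀ x)

/-! ## §2 The density of the far pusher -/

/-- **`⟪x, W x⟫ = 0` identically**: `W(x) ∥ (x − 5e₃) × e₃` is orthogonal to `x − 5e₃` and to `e₃`, hence to
`x`. [folklore] -/
theorem inner_self_farPusher (x : EuclideanSpace ℝ (Fin 3)) : ⟪x, farPusher x⟫ = 0 := by
  rw [farPusher, horizField_apply (differentiable_pusherPot x), gradient_pusherPot, Tao2016.cross_smul_left,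
    Tao2016.cross_smul_right, real_inner_smul_right, real_inner_smul_right]
  have h : ⟪x, cross (x - pusherCenter) e₃⟫ = 0 := by
    calc ⟪x, cross (x - pusherCenter) e₃⟫
        = ⟪(x - pusherCenter) + pusherCenter, cross (x - pusherCenter) e₃⟫ := by rw [sub_add_cancel]
      _ = ⟪x - pusherCenter, cross (x - pusherCenter) e₃⟫ + ⟪pusherCenter, cross (x - pusherCenter) e₃⟫ :=
          inner_add_left _ _ _
      _ = 0 := by
          rw [Tao2016.inner_self_cross_left, pusherCenter, real_inner_smul_left,
            Tao2016.inner_self_cross_right, mul_zero, add_zero]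
  rw [h, mul_zero, mul_zero]

/-- **`‖W x‖²` in closed form**: `‖W x‖² = Y₀² · ((1/8)·G(‖x − 5e₃‖²)·2)² · (‖x − 5e₃‖² − ⟪x − 5e₃, e₃⟫²)`
(`‖p × e₃‖² = ‖p‖² − ⟪p, e₃⟫²`). [folklore] -/
theorem norm_farPusher_sq (x : EuclideanSpace ℝ (Fin 3)) :
    ‖farPusher x‖ ^ 2 = TowerRates.wide.Y 0 ^ 2 * (1 / 8 * blobG (sqn 1 (x - pusherCenter)) * 2) ^ 2 *
      (‖x - pusherCenter‖ ^ 2 - ⟪x - pusherCenter, e₃⟫ ^ 2) := by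
  rw [farPusher, horizField_apply (differentiable_pusherPot x), gradient_pusherPot, Tao2016.cross_smul_left,
    Tao2016.cross_smul_right, smul_smul, norm_smul, mul_pow, Tao2016.norm_cross_sq, norm_e₃, Real.norm_eq_abs,
    sq_abs]
  ring

/-- **The density of the far pusher seen from the origin along `Y₀e₃`**:
`pusherDensity 0 (Y₀e₃) W x = 3 Y₀ ⟪x, e₃⟫ (‖x‖² ‖W x‖²) / (4π ‖x‖⁷)` (the `⟪x, W x⟫²` term is absent).
[cite: GilbargTrudinger2001, (2.13)] -/
theorem pusherDensity_farPusher (x : EuclideanSpace ℝ (Fin 3)) :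
    pusherDensity 0 (TowerRates.wide.Y 0 • e₃) farPusher x =
      3 * TowerRates.wide.Y 0 * ⟪x, e₃⟫ * (‖x‖ ^ 2 * ‖farPusher x‖ ^ 2) / (4 * π * ‖x‖ ^ 7) := by
  rw [pusherDensity, zero_sub, inner_neg_left, inner_neg_left, inner_self_farPusher, norm_neg,
    real_inner_smul_right]
  ring

/-- The density of the far pusher is nonnegative everywhere (`⟪x, e₃⟫ ≥ 15/4 > 0` on its support).
[folklore] -/
theorem pusherDensity_farPusher_nonneg (x : EuclideanSpace ℝ (Fin 3)) :
    0 ≤ pusherDensity 0 (TowerRates.wide.Y 0 • e₃) farPusher x := by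
  rw [pusherDensity_farPusher]
  have hY := Host.wide_Y_zero_pos
  by_cases hx : x ∈ tsupport pusherPot
  · have h2 := (geometry_of_mem_tsupport hx).2.1
    have : 0 ≤ ⟪x, e₃⟫ := by linarith
    positivity
  · rw [farPusher_eq_zero hx, norm_zero]
    simp

/-- **Lower bound on the ball `B(5e₃, 7/10)`**: there `⟪x, e₃⟫ ≥ 43/10` and `‖x‖ ≤ 57/10`, so
`pusherDensity 0 (Y₀e₃) W x ≥ (3/(4π)) · ((43/10)/(57/10)⁵) · Y₀ ‖W x‖²`; off the ball the density is `≥ 0`.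
[folklore] -/
theorem pusherDensity_farPusher_ge (x : EuclideanSpace ℝ (Fin 3)) :
    (ball pusherCenter (7 / 10)).indicator
        (fun x => 3 / (4 * π) * (43 / 10 / (57 / 10) ^ 5) * TowerRates.wide.Y 0 * ‖farPusher x‖ ^ 2) x ≤
      pusherDensity 0 (TowerRates.wide.Y 0 • e₃) farPusher x := by
  by_cases hx : x ∈ ball pusherCenter (7 / 10)
  · rw [indicator_of_mem hx, pusherDensity_farPusher]
    have hY := Host.wide_Y_zero_pos
    rw [mem_ball, dist_eq_norm] at hx
    -- geometry on the ball
    have hsplit : ⟪x, e₃⟫ = 5 + ⟪x - pusherCenter, e₃⟫ := by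
      rw [inner_sub_left, inner_pusherCenter_e₃]; ring
    have hle : |⟪x - pusherCenter, e₃⟫| ≤ ‖x - pusherCenter‖ * ‖e₃‖ := abs_real_inner_le_norm _ _
    rw [norm_e₃, mul_one] at hle
    have hx3 : 43 / 10 ≤ ⟪x, e₃⟫ := by rw [hsplit]; linarith [(abs_le.1 hle).1]
    have hxn : ‖x‖ ≤ 57 / 10 := by
      have : ‖x‖ ≤ ‖x - pusherCenter‖ + ‖pusherCenter‖ := norm_le_norm_sub_add x pusherCenter
      rw [norm_pusherCenter] at this; linarith
    have hxpos : 0 < ‖x‖ := by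
      have hle' : |⟪x, e₃⟫| ≤ ‖x‖ * ‖e₃‖ := abs_real_inner_le_norm _ _
      rw [norm_e₃, mul_one] at hle'
      linarith [(abs_le.1 hle').2]
    have hx5 : ‖x‖ ^ 5 ≤ (57 / 10 : ℝ) ^ 5 := pow_le_pow_left₀ (norm_nonneg _) hxn 5
    -- `w₀ ‖x‖⁵ ≤ ⟪x, e₃⟫`
    have hkey : 43 / 10 / (57 / 10 : ℝ) ^ 5 * ‖x‖ ^ 5 ≤ ⟪x, e₃⟫ := by
      calc 43 / 10 / (57 / 10 : ℝ) ^ 5 * ‖x‖ ^ 5 ≤ 43 / 10 / (57 / 10 : ℝ) ^ 5 * (57 / 10 : ℝ) ^ 5 := by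
            gcongr
        _ = 43 / 10 := by norm_num
        _ ≤ ⟪x, e₃⟫ := hx3
    have hW0 : 0 ≤ ‖farPusher x‖ ^ 2 := sq_nonneg _
    rw [le_div_iff₀ (by positivity)]
    -- `(3/(4π)) w₀ Y₀ ‖W‖² · 4π ‖x‖⁷ ≤ 3 Y₀ ⟪x, e₃⟫ ‖x‖² ‖W‖²`
    have h7 : ‖x‖ ^ 7 = ‖x‖ ^ 5 * ‖x‖ ^ 2 := by ring
    rw [h7]
    have hπ := Real.pi_pos
    have hcoef : 3 / (4 * π) * (43 / 10 / (57 / 10 : ℝ) ^ 5) * TowerRates.wide.Y 0 * ‖farPusher x‖ ^ 2 *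
        (4 * π * (‖x‖ ^ 5 * ‖x‖ ^ 2)) =
        3 * TowerRates.wide.Y 0 * (43 / 10 / (57 / 10 : ℝ) ^ 5 * ‖x‖ ^ 5) * (‖x‖ ^ 2 * ‖farPusher x‖ ^ 2) := by
      field_simp
    rw [hcoef]
    have hA : 0 ≤ 3 * TowerRates.wide.Y 0 := by positivity
    have hB : 0 ≤ ‖x‖ ^ 2 * ‖farPusher x‖ ^ 2 := by positivity
    exact mul_le_mul_of_nonneg_right (mul_le_mul_of_nonneg_left hkey hA) hB
  · rw [indicator_of_notMem hx]
    exact pusherDensity_farPusher_nonneg x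

/-! ## §3 The pusher's energy on the ball `B(5e₃, 7/10)` -/

/-- **`‖W(5e₃ + p)‖²` on the flat zone of the potential** (`‖p‖ < 7/10`):
`‖W(5e₃ + p)‖² = (9/4) Y₀² ‖p‖⁴ (1 − ‖p‖²)² (‖p‖² − p₂²)` (`G = −6s + 6s²`, `s = ‖p‖² ≤ 1/2`). [folklore] -/
theorem norm_farPusher_center_add_sq {p : EuclideanSpace ℝ (Fin 3)} (hp : ‖p‖ < 7 / 10) :
    ‖farPusher (pusherCenter + p)‖ ^ 2 =
      TowerRates.wide.Y 0 ^ 2 * (9 / 4) *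
        ((‖p‖ ^ 4 * (1 - ‖p‖ ^ 2) ^ 2) * ‖p‖ ^ 2 - (‖p‖ ^ 4 * (1 - ‖p‖ ^ 2) ^ 2) * p 2 ^ 2) := by
  have hs : sqn 1 p ≤ 1 / 2 := by
    rw [sqn_one]; nlinarith [norm_nonneg p]
  rw [norm_farPusher_sq, add_sub_cancel_left, blobG_of_le_half hs, sqn_one, inner_e₃_right]
  ring

/-- The weights `p ↦ ‖p‖⁴(1 − ‖p‖²)² ‖p‖²` and `p ↦ ‖p‖⁴(1 − ‖p‖²)² p₂²` are integrable on a ball. [folklore] -/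
theorem integrableOn_ball_weights (R : ℝ) :
    IntegrableOn (fun p : EuclideanSpace ℝ (Fin 3) => ‖p‖ ^ 4 * (1 - ‖p‖ ^ 2) ^ 2 * ‖p‖ ^ 2) (ball 0 R) volume ∧
      IntegrableOn (fun p : EuclideanSpace ℝ (Fin 3) => ‖p‖ ^ 4 * (1 - ‖p‖ ^ 2) ^ 2 * p 2 ^ 2) (ball 0 R)
        volume := by
  have hg : Continuous fun p : EuclideanSpace ℝ (Fin 3) => ‖p‖ ^ 4 * (1 - ‖p‖ ^ 2) ^ 2 := by fun_prop
  have h2 : Continuous fun p : EuclideanSpace ℝ (Fin 3) => p 2 :=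
    (continuous_apply (2 : Fin 3)).comp (PiLp.continuous_ofLp 2 _)
  constructor
  · exact ((hg.mul (continuous_norm.pow 2)).continuousOn.integrableOn_compact
      (isCompact_closedBall (0 : EuclideanSpace ℝ (Fin 3)) R)).mono_set ball_subset_closedBall
  · exact ((hg.mul (h2.pow 2)).continuousOn.integrableOn_compact
      (isCompact_closedBall (0 : EuclideanSpace ℝ (Fin 3)) R)).mono_set ball_subset_closedBall

/-- **The one-variable integral** `∫₀^{7/10} r⁴ · r⁴(1 − r²)² dr = (7/10)⁹/9 − 2(7/10)¹¹/11 + (7/10)¹³/13`.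
[folklore] -/
theorem integral_rate_poly :
    ∫ r in (0 : ℝ)..(7 / 10), r ^ 4 * (r ^ 4 * (1 - r ^ 2) ^ 2) =
      (7 / 10 : ℝ) ^ 9 / 9 - 2 * (7 / 10 : ℝ) ^ 11 / 11 + (7 / 10 : ℝ) ^ 13 / 13 := by
  have h : ∫ r in (0 : ℝ)..(7 / 10), r ^ 4 * (r ^ 4 * (1 - r ^ 2) ^ 2) =
      ∫ r in (0 : ℝ)..(7 / 10), (r ^ 8 - 2 * r ^ 10 + r ^ 12) :=
    intervalIntegral.integral_congr fun r _ => by ring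
  have i8 : IntervalIntegrable (fun r : ℝ => r ^ 8) volume 0 (7 / 10) := (continuous_pow 8).intervalIntegrable _ _
  have i10 : IntervalIntegrable (fun r : ℝ => 2 * r ^ 10) volume 0 (7 / 10) :=
    (continuous_const.mul (continuous_pow 10)).intervalIntegrable _ _
  have i12 : IntervalIntegrable (fun r : ℝ => r ^ 12) volume 0 (7 / 10) := (continuous_pow 12).intervalIntegrable _ _
  rw [h, intervalIntegral.integral_add (i8.sub i10) i12, intervalIntegral.integral_sub i8 i10,
    intervalIntegral.integral_const_mul, integral_pow, integral_pow, integral_pow]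
  norm_num

/-- **THE PUSHER'S ENERGY ON `B(5e₃, 7/10)`, EXACTLY**:
`∫_{B(5e₃, 7/10)} ‖W‖² = 6π · ((7/10)⁹/9 − 2(7/10)¹¹/11 + (7/10)¹³/13) · Y₀²` (translate to the origin, closed
form on the flat zone, polar coordinates `∫ g(|p|)|p|² = 4π∫r⁴g`, weighted moment `∫ g(|p|)p₂² = (4π/3)∫r⁴g`).
[cite: Folland1999, Thm. 2.49] -/
theorem setIntegral_ball_norm_farPusher_sq :
    ∫ x in ball pusherCenter (7 / 10), ‖farPusher x‖ ^ 2 =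
      6 * π * ((7 / 10 : ℝ) ^ 9 / 9 - 2 * (7 / 10 : ℝ) ^ 11 / 11 + (7 / 10 : ℝ) ^ 13 / 13) *
        TowerRates.wide.Y 0 ^ 2 := by
  -- translate to the origin
  have hmp : MeasurePreserving (fun p : EuclideanSpace ℝ (Fin 3) => pusherCenter + p) volume volume :=
    measurePreserving_add_left volume pusherCenter
  have hemb : MeasurableEmbedding (fun p : EuclideanSpace ℝ (Fin 3) => pusherCenter + p) :=
    (Homeomorph.addLeft pusherCenter).measurableEmbedding
  have hpre : (fun p : EuclideanSpace ℝ (Fin 3) => pusherCenter + p) ⁻¹' ball pusherCenter (7 / 10) =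
      ball 0 (7 / 10) := by
    ext p
    simp [mem_ball, dist_eq_norm]
  have h := hmp.setIntegral_preimage_emb hemb (fun x => ‖farPusher x‖ ^ 2) (ball pusherCenter (7 / 10))
  rw [hpre] at h
  rw [← h]
  -- closed form on the ball
  have hcongr : ∫ p in ball (0 : EuclideanSpace ℝ (Fin 3)) (7 / 10), ‖farPusher (pusherCenter + p)‖ ^ 2 =
      ∫ p in ball (0 : EuclideanSpace ℝ (Fin 3)) (7 / 10), TowerRates.wide.Y 0 ^ 2 * (9 / 4) *
        ((‖p‖ ^ 4 * (1 - ‖p‖ ^ 2) ^ 2) * ‖p‖ ^ 2 - (‖p‖ ^ 4 * (1 - ‖p‖ ^ 2) ^ 2) * p 2 ^ 2) := by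
    refine setIntegral_congr_fun measurableSet_ball fun p hp => ?_
    rw [mem_ball, dist_zero_right] at hp
    exact norm_farPusher_center_add_sq hp
  rw [hcongr, integral_const_mul, integral_sub (integrableOn_ball_weights _).1 (integrableOn_ball_weights _).2]
  -- the two radial moments
  have hg : Continuous fun r : ℝ => r ^ 4 * (1 - r ^ 2) ^ 2 := by fun_prop
  have hR : (0 : ℝ) ≤ 7 / 10 := by norm_num
  have m1 := integral_ball_radial_mul_norm_sq (fun r : ℝ => r ^ 4 * (1 - r ^ 2) ^ 2) hR
  have m2 := integral_ball_radial_mul_apply_sq hg hR (2 : Fin 3)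
  simp only at m1 m2
  rw [m1, m2, integral_rate_poly]
  ring

/-! ## §4 The quantitative anchor rate of the strict tiny profile -/

section Rate

variable {a : ℝ}

/-- The origin is off the pusher's support. [folklore] -/
theorem zero_notMem_tsupport_farPusher : (0 : EuclideanSpace ℝ (Fin 3)) ∉ tsupport farPusher := fun h =>
  notMem_tsupport_of_norm_lt (by simp) (tsupport_farPusher_subset h)

/-- **The anchor value of the strict tiny profile IS the integral of the far pusher's density**, at every
viscosity: `⟪U(0), accel ν U 0⟫ = ∫ pusherDensity 0 (Y₀e₃) W`. [cite: MajdaBertozziCUP2002, §1.8 Prop. 1.16] -/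
theorem inner_accel_strictTinyProfile_zero_eq (ha : 0 < a) (h5 : a ≤ 5 / 256) (ν : ℝ) :
    ⟪strictTinyProfile a 0, accel ν (strictTinyProfile a) 0⟫ =
      ∫ x, pusherDensity 0 (TowerRates.wide.Y 0 • e₃) farPusher x := by
  have hd : Disjoint (tsupport (tinyProfile a)) (tsupport farPusher) :=
    (disjoint_tsupport ha h5).mono_right tsupport_farPusher_subset
  have hfar : ∀ x ∈ tsupport farPusher, (1 : ℝ) < ‖(0 : EuclideanSpace ℝ (Fin 3)) - x‖ := fun x hx => by
    rw [zero_sub, norm_neg]; linarith [(geometry_of_mem_tsupport (tsupport_farPusher_subset hx)).2.2]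
  have hperp : ∀ x, ⟪farPusher x, tinyProfile a 0⟫ = 0 := fun x => by
    rw [tinyProfile_zero, real_inner_smul_right, inner_farPusher_e₃, mul_zero]
  rw [strictTinyProfile, ← tinyProfile_zero a]
  exact inner_accel_eq_integral_pusherDensity (contDiff_tinyProfile a) (hasCompactSupport_tinyProfile ha)
    (isDivFree_tinyProfile ha.ne') (isEvenAbout_tinyProfile a) (laplacian_tinyProfile_zero a)
    contDiff_farPusher hasCompactSupport_farPusher isDivFree_farPusher hd one_pos hfar hperp

/-- **THE INTEGRAL OF THE FAR PUSHER'S DENSITY**: `Y₀³/200000 ≤ ∫ pusherDensity 0 (Y₀e₃) W` (the integral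
dominates `(3/(4π))·(43/10)(57/10)⁻⁵ · Y₀ · 6πJ Y₀² = (9/2)(43/10)(57/10)⁻⁵ J · Y₀³ ≥ Y₀³/200000`). This number
depends on the pusher alone — NOT on the carrier. [cite: GilbargTrudinger2001, Lemma 4.1] -/
theorem integral_pusherDensity_farPusher_ge :
    TowerRates.wide.Y 0 ^ 3 / 200000 ≤ ∫ x, pusherDensity 0 (TowerRates.wide.Y 0 • e₃) farPusher x := by
  have hY := Host.wide_Y_zero_pos
  have hπ := Real.pi_pos
  set w : ℝ := 3 / (4 * π) * (43 / 10 / (57 / 10) ^ 5) * TowerRates.wide.Y 0 with hw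
  have hint : Integrable (pusherDensity 0 (TowerRates.wide.Y 0 • e₃) farPusher) :=
    (continuous_pusherDensity contDiff_farPusher.continuous zero_notMem_tsupport_farPusher).integrable_of_hasCompactSupport
      (hasCompactSupport_pusherDensity hasCompactSupport_farPusher)
  have hWi : IntegrableOn (fun x => w * ‖farPusher x‖ ^ 2) (ball pusherCenter (7 / 10)) volume :=
    ((continuous_const.mul (contDiff_farPusher.continuous.norm.pow 2)).continuousOn.integrableOn_compact
      (isCompact_closedBall pusherCenter (7 / 10))).mono_set ball_subset_closedBall
  have hint2 : Integrable ((ball pusherCenter (7 / 10)).indicator fun x => w * ‖farPusher x‖ ^ 2) :=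
    (integrable_indicator_iff measurableSet_ball).2 hWi
  have hmono : ∫ x, (ball pusherCenter (7 / 10)).indicator (fun x => w * ‖farPusher x‖ ^ 2) x ≤
      ∫ x, pusherDensity 0 (TowerRates.wide.Y 0 • e₃) farPusher x :=
    integral_mono hint2 hint fun x => by rw [hw]; exact pusherDensity_farPusher_ge x
  have hval : ∫ x, (ball pusherCenter (7 / 10)).indicator (fun x => w * ‖farPusher x‖ ^ 2) x =
      w * (6 * π * ((7 / 10 : ℝ) ^ 9 / 9 - 2 * (7 / 10 : ℝ) ^ 11 / 11 + (7 / 10 : ℝ) ^ 13 / 13) *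
        TowerRates.wide.Y 0 ^ 2) := by
    rw [integral_indicator measurableSet_ball, integral_const_mul, setIntegral_ball_norm_farPusher_sq]
  have hnum : TowerRates.wide.Y 0 ^ 3 / 200000 ≤
      w * (6 * π * ((7 / 10 : ℝ) ^ 9 / 9 - 2 * (7 / 10 : ℝ) ^ 11 / 11 + (7 / 10 : ℝ) ^ 13 / 13) *
        TowerRates.wide.Y 0 ^ 2) := by
    have hre : w * (6 * π * ((7 / 10 : ℝ) ^ 9 / 9 - 2 * (7 / 10 : ℝ) ^ 11 / 11 + (7 / 10 : ℝ) ^ 13 / 13) *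
        TowerRates.wide.Y 0 ^ 2) =
        9 / 2 * (43 / 10 / (57 / 10) ^ 5) *
          ((7 / 10 : ℝ) ^ 9 / 9 - 2 * (7 / 10 : ℝ) ^ 11 / 11 + (7 / 10 : ℝ) ^ 13 / 13) * TowerRates.wide.Y 0 ^ 3 := by
      rw [hw]; field_simp; ring
    rw [hre, div_eq_mul_inv, mul_comm (TowerRates.wide.Y 0 ^ 3)]
    refine mul_le_mul_of_nonneg_right ?_ (by positivity)
    norm_num
  exact hnum.trans (hval ▸ hmono)

/-- **THE FAR PUSHER'S RATE IS CARRIER-INDEPENDENT.** For ANY flat even carrier — `U₁ ∈ C_c^∞` divergence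
free, `tsupport U₁ ⊆ B̄(0, ρ₁)` with `ρ₁ < 15/4`, even about `0`, `ΔU₁(0) = 0`, `U₁(0) = Y₀ e₃` — the composite
`U₁ + W` has `Y₀³/200000 ≤ ⟪(U₁ + W)(0), accel ν (U₁ + W) 0⟫` at every viscosity `ν`: the explicit pusher adds
a NUMERIC rising rate to every such design (large carriers included). [cite: MajdaBertozziCUP2002, §1.8 Prop. 1.16] -/
theorem rate_add_farPusher_ge {U₁ : EuclideanSpace ℝ (Fin 3) → EuclideanSpace ℝ (Fin 3)} {ρ₁ : ℝ}
    (h₁ : ContDiff ℝ ∞ U₁) (hsupp : tsupport U₁ ⊆ closedBall 0 ρ₁) (hρ₁ : ρ₁ < 15 / 4)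
    (hdiv₁ : VectorCalculus.IsDivFree U₁) (he : IsEvenAbout 0 U₁) (hflat : (Δ U₁) 0 = 0)
    (h0 : U₁ 0 = TowerRates.wide.Y 0 • e₃) (ν : ℝ) :
    TowerRates.wide.Y 0 ^ 3 / 200000 ≤ ⟪(U₁ + farPusher) 0, accel ν (U₁ + farPusher) 0⟫ := by
  have h₁c : HasCompactSupport U₁ :=
    (isCompact_closedBall (0 : EuclideanSpace ℝ (Fin 3)) ρ₁).of_isClosed_subset (isClosed_tsupport _) hsupp
  have hd : Disjoint (tsupport U₁) (tsupport farPusher) := by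
    refine Set.disjoint_left.2 fun x hx hx' => ?_
    have h1 : ‖x‖ ≤ ρ₁ := by
      have := hsupp hx
      rwa [mem_closedBall, dist_zero_right] at this
    have h2 := (geometry_of_mem_tsupport (tsupport_farPusher_subset hx')).2.2
    linarith
  have hfar : ∀ x ∈ tsupport farPusher, (1 : ℝ) < ‖(0 : EuclideanSpace ℝ (Fin 3)) - x‖ := fun x hx => by
    rw [zero_sub, norm_neg]; linarith [(geometry_of_mem_tsupport (tsupport_farPusher_subset hx)).2.2]
  have hperp : ∀ x, ⟪farPusher x, U₁ 0⟫ = 0 := fun x => by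
    rw [h0, real_inner_smul_right, inner_farPusher_e₃, mul_zero]
  rw [inner_accel_eq_integral_pusherDensity h₁ h₁c hdiv₁ he hflat contDiff_farPusher hasCompactSupport_farPusher
    isDivFree_farPusher hd one_pos hfar hperp, h0]
  exact integral_pusherDensity_farPusher_ge

/-- **THE QUANTITATIVE ANCHOR RATE OF THE STRICT TINY PROFILE**: `Y₀³/200000 ≤ ⟪U(0), accel ν U 0⟫` for
`U = strictTinyProfile a`, `0 < a ≤ 5/256`, at every viscosity `ν`. [cite: MajdaBertozziCUP2002, §1.8 Prop. 1.16] -/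
theorem rate_strictTinyProfile_ge (ha : 0 < a) (h5 : a ≤ 5 / 256) (ν : ℝ) :
    TowerRates.wide.Y 0 ^ 3 / 200000 ≤ ⟪strictTinyProfile a 0, accel ν (strictTinyProfile a) 0⟫ := by
  rw [inner_accel_strictTinyProfile_zero_eq ha h5 ν]
  exact integral_pusherDensity_farPusher_ge

/-- **… on the argmax** (which is `{0}`): `‖U x‖ = Y₀ → Y₀³/200000 ≤ ⟪U x, accel 1 U x⟫` — a NUMERIC lower bound
for the slot's `rate` of the strict tiny profile. [cite: Palasek2026ElementaryModel, §3.3] -/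
theorem anchor_strictTinyProfile_ge (ha : 0 < a) (h5 : a ≤ 5 / 256) (x : EuclideanSpace ℝ (Fin 3))
    (hx : ‖strictTinyProfile a x‖ = TowerRates.wide.Y 0) :
    TowerRates.wide.Y 0 ^ 3 / 200000 ≤ ⟪strictTinyProfile a x, accel 1 (strictTinyProfile a) x⟫ := by
  obtain rfl := eq_zero_of_norm_strictTinyProfile_eq ha h5 hx
  exact rate_strictTinyProfile_ge ha h5 1

end Rate

end Summit.NavierStokesRegularity.FluidComputer.PalasekTowerClayBridge.Germ

end
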